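import Summits.BirchSwinnertonDyer.BirchSwinnertonDyer.Theorems.SchneiderFreeAdditiveX3SemistableTwistLocalThreeAnomalous
import Summits.BirchSwinnertonDyer.Rank1Residual.X2.TateLineDecomposition
import Literature.NumberTheory.EllipticCurves.TateCurve.NumberFieldUniformization
import HarnessLib

/-!
# Route `SchneiderFreeAdditiveX3` (K1 door), NEGATIVE companion at `p = 3` on the (M) cell: for a SPLIT multiplicative twist
# CGLS's local hypothesis FAILS at every rational line of `W = V ⊗ χ_{−3}` — the non-split clause of `…SemistableTwistLocalThreeMult`
# is SHARP, and ONE abstract lemma («a `D`-line of `V[3]` with trivial quotient kills `hna` for the `(−3)`-twist») covers both cells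

Cell `bsd-schneider-ideate`, seat `bsd-schneider-door-c5` (prover, generation 26; assembly layer; `--supports` 19177).
PARTITION: board row B6 ∩ X3 ∩ sst-twist, `r = 1`, (M) half at `p = 3` (4 383 pairs) of `Rank1Residual.partition`; a TYPED OBSTRUCTION
(negative lemma) for the 3 256 pairs of that cell whose `(−3)`-twist is SPLIT multiplicative (census kit j319291): there the hypothesis
«`θ|_{G_v̄} ∉ {𝟙, ω}`» of Castella–Grossi–Lee–Skinner 2022 Prop. 14 is FALSE for the residual characters, so the published-fact road of
generations 23–25 ([INV.μ], the `λ`-count and the door inequality from Prop. 14 / Cor. 1.2.6) cannot serve them; types-the-object-of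
nothing; closes none of B6's cells (BSD NOT advanced).  bears_on: K1-door (19177 r3; FYI 19176 r2, the (M) cell's crux).

WHAT.  Generation 25 proved the (G-ord) negative lemma `not_hna_of_goodOrd_negThree_twist_of_anomalous` from ONE local datum: a line
`K ≤ V[3]` of order `3` at a prime `𝔓 ∣ 3` with `g x − x ∈ K` for EVERY `g ∈ D_𝔓` (trivial quotient).  The rest of that proof never looks at
the reduction type of `V`.  This file records the abstract step and feeds it the SPLIT multiplicative datum:
* §1 `exists_line_trivialQuot_of_split` — `V/ℚ` globally minimal with SPLIT multiplicative reduction at an odd `p`, `v ∋ p`: the Tate line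
  `X₀ = C[p] ≤ V[p]` of the UNTWISTED uniformisation (Silverman *ATAEC* V.5.3, the tree's PROVED `Silverman1994_thmV53_tateUniformisation_holds`)
  has order `p` and `D_v` acts trivially on `V[p]/X₀` (`X2.GreenbergVatsalTateFrobeniusSign.smul_sub_mem_of_equivariant`) — the datum of
  X2's `fix_or_quot_of_split`, exported at the prime `adicCompletionPrime ℚ v`.
* §2 **`not_hna_of_line_trivialQuot_negThree_twist`** — ABSTRACT: `W = C • V^{(−3)}` with `W[3]` reducible, and a line `K ≤ V[3]` of order `3`
  at some `𝔓 ∣ 3` with `D_𝔓` trivial on `V[3]/K` ⟹ the `hna` binder of generations 23–25 is FALSE at `p = 3`.  (`D_𝔓` acts on `K` through the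
  determinant `χ̄_3` (`MixedCongruence.smul_eq_cyclotomic_zsmul_of_forall_sub_mem`) and `ε_{−3} = χ̄_3` EXACTLY (generation 25's
  `modPCyclotomicCharacterZMod_three_eq_one_iff`), so under the sign-equivariant transport `e : W[3] ≃ V[3]` the line `e⁻¹(K)` is fixed
  POINTWISE and every other `D`-stable line has trivial quotient; a rational line is one or the other.)  Generation 25's §3 is the
  instance `K` = kernel of reduction of an anomalous good-ordinary `V`; this file's §3 is the instance `K` = Tate line of a split `V`.
* §3 `not_hna_of_splitMult_negThree_twist` and the cell form **`not_hna_of_classX3_of_subM_of_exists_split_twist`**: on the (M) cell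
  (`ClassX3 W 3 ∧ SubM W 3`) a SPLIT multiplicative `(−3)`-twist model kills `hna` — the census dichotomy 1 127 / 3 256 (non-split / split
  twist, kit j319291) is exact at theorem level, as 686 / 1 725 is on the (G-ord) cell.

HONEST FRAMING: theorems only (finite group theory on the `𝔽_3`-plane over tree theorems; the Tate uniformisation is the tree's PROVED
`_holds` theorem); no definition, no named fact, no `sorry`; a NEGATIVE statement about a HYPOTHESIS (CGLS Prop. 14's local clause), not about
any conjecture: nothing is refuted, no main conjecture or BSD statement is touched; for these pairs no published or preprint text supplies the
(M) door (crux r2 is NOT in print); «closes rung: none».  References: Silverman *ATAEC* V.3.1, V.5.3 [SilvermanATAEC1994]; Greenberg–Vatsal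
2000 §2 [GreenbergVatsal2000]; Serre 1972 §1.12 [Serre1972]; CGLS 2022 §1.2 [CastellaGrossiLeeSkinner2022]; Keller–Yin arXiv:2402.12781
§1 and arXiv:2410.23241 §3 [KellerYin2024, KellerYin2024b].
-/

set_option autoImplicit false
set_option linter.dupNamespace false -- the summit namespace `…BirchSwinnertonDyer.BirchSwinnertonDyer.Theorems` (Sub = Summit, D-0017) trips it

noncomputable section

open scoped Classical NumberField Pointwise

open WeierstrassCurve NumberField IsDedekindDomain Field Rat.HeightOneSpectrum
  Literature.NumberTheory.EllipticCurves Literature.NumberTheory.GaloisRepresentations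
  Literature.NumberTheory.EllipticCurves.GreenbergSelmer
  Literature.NumberTheory.EllipticCurves.Rank1Residual
  Summit.BirchSwinnertonDyer.Rank1Residual Summit.BirchSwinnertonDyer.Rank1Residual.GaloisImage
  Summit.BirchSwinnertonDyer.Rank1Residual.Additive Summit.BirchSwinnertonDyer.Rank1Residual.AdditivePotMult
  Summit.BirchSwinnertonDyer.Rank1Residual.X2
  Summit.BirchSwinnertonDyer.Rank1Residual.X2.GreenbergVatsalTateDatum
  Summit.BirchSwinnertonDyer.Rank1Residual.X2.GreenbergVatsalTateDatumSign
  Summit.BirchSwinnertonDyer.Rank1Residual.X2.GreenbergVatsalTateDatumTorsion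
  Summit.BirchSwinnertonDyer.Rank1Residual.X2.GreenbergVatsalTateDatumCofree
  Summit.BirchSwinnertonDyer.Rank1Residual.X2.GreenbergVatsalTateFrobeniusSign
  Summit.BirchSwinnertonDyer.BirchSwinnertonDyer.Theorems.SchneiderFreeAdditiveX3.SemistableTwistLocal

namespace Summit.BirchSwinnertonDyer.BirchSwinnertonDyer.Theorems.SchneiderFreeAdditiveX3.SemistableTwistLocalThree

/-! ### §1 The Tate line of a SPLIT multiplicative curve: order `p`, trivial quotient under `D_v` -/

section Split

variable (V : WeierstrassCurve ℚ) [V.IsElliptic] (p : ℕ) [hp : Fact p.Prime]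

/-- **SPLIT odd `p ‖ N_V`: a line `X₀ ≤ V[p]` of order `p` at the place `v ∋ p` with `g • P − P ∈ X₀` for EVERY `g ∈ D_v` and every
`P ∈ V[p]`** — the Tate line `C ∩ V[p]` of the UNTWISTED uniformisation `Ψ : K̄_vˣ ↠ V(K̄_v)` (Silverman *ATAEC* V.5.3 with V.3.1 (c)(d), the
tree's PROVED `Silverman1994_thmV53_tateUniformisation_holds`): `#X₀ = p` (`natCard_tateDatum_plus_inf_torsionBy`) and `Γ_{ℚ_v}` acts
trivially on `V[p^∞]/C` (`smul_sub_mem_of_equivariant`).  This is the datum inside X2's `fix_or_quot_of_split`, exported.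
[cite: SilvermanATAEC1994, Ch. V Thm. 3.1 (c),(d) and Thm. 5.3 (a),(b)] [cite: GreenbergVatsal2000, §2 pp. 14–15] -/
theorem exists_line_trivialQuot_of_split (hsplit : V.HasSplitMultiplicativeReductionAtPrime p)
    {v : HeightOneSpectrum (𝓞 ℚ)} (hpv : ((p : ℕ) : 𝓞 ℚ) ∈ v.asIdeal) :
    ∃ X : AddSubgroup (geomTorsion V (p : ℤ)), Nat.card X = p ∧
      ∀ g ∈ decomp (K := ℚ) v, ∀ P : geomTorsion V (p : ℤ), g • P - P ∈ X := by
  obtain ⟨q, Ψ, hq0, hq1, hsurj, hker, hΨσ, -⟩ :=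
    TateCurve.Silverman1994_thmV53_tateUniformisation_holds V v
      (GreenbergVatsalStrictSelmerMultiplicative.hasSplitMultiplicativeReductionAt_of_mem V p hsplit hpv)
  have hker' : ∀ u : (AlgebraicClosure (v.adicCompletion ℚ))ˣ, Ψ (Additive.ofMul u) = 0 →
      ∃ a : ℤ, (u : AlgebraicClosure (v.adicCompletion ℚ)) =
        algebraMap (v.adicCompletion ℚ) (AlgebraicClosure (v.adicCompletion ℚ)) q ^ a :=
    fun u h ↦ (hker u).1 h
  set N := tateDatum V p Ψ (sign_disj V Ψ 0 (sign_of_equivariant V Ψ hΨσ)) with hN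
  set X := N.plus.comap (AddSubgroup.inclusion (geomTorsion_le_geomPrimaryTorsion V p)) with hXdef
  have hXcard : Nat.card X = p := by
    rw [hXdef, TateLineDecomposition.natCard_comap_eq V p N, hN]
    exact natCard_tateDatum_plus_inf_torsionBy V p Ψ _ hq0 hq1 hker'
  refine ⟨X, hXcard, ?_⟩
  rintro g ⟨σ, rfl⟩ P
  have h := TateLineDecomposition.smul_sub_zsmul_mem_comap V p N (g := absGaloisRestrict ℚ (v.adicCompletion ℚ) σ)
    (s := 1) (fun m ↦ by
      rw [one_zsmul]; exact smul_sub_mem_of_equivariant V p Ψ hΨσ hsurj hker' σ m) P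
  rwa [one_zsmul] at h

/-- The same datum at the PRIME `adicCompletionPrime ℚ v ∈ v.primesAbove` (whose decomposition group is `D_v`), in the shape consumed by §2.
[cite: SilvermanATAEC1994, Ch. V Thm. 3.1 (c),(d) and Thm. 5.3 (a),(b)] -/
theorem exists_prime_line_trivialQuot_of_split (hsplit : V.HasSplitMultiplicativeReductionAtPrime p)
    {v : HeightOneSpectrum (𝓞 ℚ)} (hpv : ((p : ℕ) : 𝓞 ℚ) ∈ v.asIdeal) :
    ∃ 𝔓 ∈ v.primesAbove, ∃ X : AddSubgroup (geomTorsion V (p : ℤ)), Nat.card X = p ∧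
      ∀ g ∈ 𝔓.decompositionSubgroup (absoluteGaloisGroup ℚ), ∀ P : geomTorsion V (p : ℤ), g • P - P ∈ X := by
  obtain ⟨X, hX, hDX⟩ := exists_line_trivialQuot_of_split V p hsplit hpv
  refine ⟨adicCompletionPrime ℚ v, adicCompletionPrime_mem_primesAbove ℚ v, X, hX, fun g hg ↦ hDX g ?_⟩
  have hD : (adicCompletionPrime ℚ v).decompositionSubgroup (absoluteGaloisGroup ℚ) = decomp (K := ℚ) v := by
    rw [decompositionSubgroup_adicCompletionPrime_eq_range]; rfl
  exact hD ▸ hg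

end Split

/-! ### §2 ABSTRACT: a `D`-line of `V[3]` with trivial quotient kills `hna` for `W = C • V^{(−3)}` -/

section Abstract

variable {V W : WeierstrassCurve ℚ} [V.IsElliptic] [W.IsElliptic]

/-- **ABSTRACT negative lemma at `p = 3`.**  `V/ℚ` globally minimal, `W = C • V^{(−3)}` with `W[3]` reducible; suppose that at some prime
`𝔓 ∣ 3` there is a line `K ≤ V[3]` of order `3` with `g x − x ∈ K` for EVERY `g ∈ D_𝔓` (trivial quotient).  Then CGLS's local clause FAILS:
it is NOT the case that for every `v ∋ 3`, every rational line `Φ ≤ W[3]` and every `𝔓 ∣ v`, `D_𝔓` neither fixes `Φ` pointwise nor acts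
trivially on `W[3]/Φ`.  Proof (generation 25's, verbatim from its fourth line): `D_𝔓` acts on `K` through the determinant, i.e. by
`χ̄_3(g)` (`MixedCongruence.smul_eq_cyclotomic_zsmul_of_forall_sub_mem`), and `ε_{−3}(g) = χ̄_3(g)` (`modPCyclotomicCharacterZMod_three_eq_one_iff`);
under the sign-equivariant transport `e : W[3] ≃ V[3]` (`exists_signEquiv_of_twist`) the twisted action fixes `e⁻¹(K)` pointwise and is trivial
on `W[3]/Φ` for every `Γ_ℚ`-stable line `Φ` with `e(Φ) ⊓ K = ⊥`; a rational line is `e⁻¹(K)` or complementary (`line_eq_or_inf_eq_bot`).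
Instances: `K` = kernel of reduction of an ANOMALOUS good-ordinary `V` (generation 25, §3 of `…LocalThreeAnomalous`); `K` = Tate line of a
SPLIT multiplicative `V` (§3 below). [cite: Serre1972, §1.11 and §1.12] [cite: CastellaGrossiLeeSkinner2022, §1.2 (hypothesis θ|_{G_v̄} ≠ 𝟙, ω)] -/
theorem not_hna_of_line_trivialQuot_negThree_twist (C : VariableChange ℚ) (hC : C • V.quadraticTwist (-3 : ℚ) = W) (hred : Red W 3)
    {v : HeightOneSpectrum (𝓞 ℚ)} (hpv : ((3 : ℕ) : 𝓞 ℚ) ∈ v.asIdeal)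
    {𝔓 : Ideal (absIntegers (𝓞 ℚ) ℚ)} (h𝔓 : 𝔓 ∈ v.primesAbove)
    {K : AddSubgroup (geomTorsion V (3 : ℤ))} (hK : Nat.card K = 3)
    (hKD : ∀ g ∈ 𝔓.decompositionSubgroup (absoluteGaloisGroup ℚ), ∀ x : geomTorsion V (3 : ℤ), g • x - x ∈ K) :
    ¬ ∀ (v : HeightOneSpectrum (𝓞 ℚ)), ((3 : ℕ) : 𝓞 ℚ) ∈ v.asIdeal →
      ∀ (Φ : AddSubgroup (geomTorsion W (3 : ℤ))), IsRationalLine W 3 Φ →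
      ∀ 𝔓 ∈ v.primesAbove,
        (¬ ∀ g ∈ 𝔓.decompositionSubgroup (absoluteGaloisGroup ℚ), ∀ P ∈ Φ, g • P = P) ∧
          (¬ ∀ g ∈ 𝔓.decompositionSubgroup (absoluteGaloisGroup ℚ),
            ∀ P : geomTorsion W (3 : ℤ), g • P - P ∈ Φ) := by
  intro hna
  have hpP : Nat.Prime 3 := Fact.out
  obtain ⟨Φ, hΦ⟩ := exists_isRationalLine_of_not_irr W 3 hred
  obtain ⟨h1, h2⟩ := hna v hpv Φ hΦ 𝔓 h𝔓
  -- the sign-equivariant twisting isomorphism `e : W[3] ≃ V[3]` (sign `ε_{−3} = χ̄_3`)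
  have hd0 : (-3 : ℚ) ≠ 0 := by norm_num
  have hC' : C⁻¹ • W = V.quadraticTwist (-3 : ℚ) := by rw [← hC, inv_smul_smul]
  obtain ⟨e, hpos, hneg⟩ := exists_signEquiv_of_twist (W := V) (Wd := W) (p := 3) hd0 C⁻¹ hC'
  set ΦV : AddSubgroup (geomTorsion V (3 : ℤ)) := Φ.map e.toAddMonoidHom with hΦV
  have hmem : ∀ P, e P ∈ ΦV ↔ P ∈ Φ := fun P ↦ by
    rw [hΦV, AddSubgroup.mem_map_equiv, AddEquiv.symm_apply_apply]
  have hΦVcard : Nat.card ΦV = 3 :=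
    (Nat.card_congr (Φ.equivMapOfInjective e.toAddMonoidHom e.injective).toEquiv).symm.trans hΦ.1
  have hstab : ∀ (σ : absoluteGaloisGroup ℚ), ∀ T ∈ ΦV, σ • T ∈ ΦV := by
    intro σ T hT
    obtain ⟨P, rfl⟩ : ∃ P, e P = T := ⟨e.symm T, e.apply_symm_apply T⟩
    have hP : P ∈ Φ := (hmem P).mp hT
    by_cases hsg : σ • geomSqrt (-3 : ℚ) = geomSqrt (-3 : ℚ)
    · rw [← hpos σ hsg, hmem]; exact hΦ.2 σ P hP
    · have h1 : σ • e P = -e (σ • P) := by rw [hneg σ hsg, neg_neg]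
      rw [h1, ← map_neg, hmem]; exact Φ.neg_mem (hΦ.2 σ P hP)
  -- how `g ∈ D` acts on `V[3]`: trivially on `V[3]/K`, by the sign `ε(g)` on `K`
  have hKact : ∀ g ∈ 𝔓.decompositionSubgroup (absoluteGaloisGroup ℚ), ∀ k ∈ K,
      (g • geomSqrt (-3 : ℚ) = geomSqrt (-3 : ℚ) → g • k = k) ∧ (¬ g • geomSqrt (-3 : ℚ) = geomSqrt (-3 : ℚ) → g • k = -k) := by
    intro g hg k hk
    have hcyc := MixedCongruence.smul_eq_cyclotomic_zsmul_of_forall_sub_mem V 3 g hK (hKD g hg) hk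
    refine ⟨fun hfix ↦ ?_, fun hmov ↦ ?_⟩
    · rw [hcyc, (modPCyclotomicCharacterZMod_three_eq_one_iff g).mpr hfix, Units.val_one, ZMod.val_one, Nat.cast_one, one_smul]
    · have hχ : modPCyclotomicCharacterZMod ℚ 3 g = -1 := by
        rcases ZMod.units_three_eq_one_or (modPCyclotomicCharacterZMod ℚ 3 g) with h | h
        · exact absurd ((modPCyclotomicCharacterZMod_three_eq_one_iff g).mp h) hmov
        · exact h
      have hval : (-1 : ZMod 3).val = 2 := by decide
      rw [hcyc, hχ, Units.val_neg, Units.val_one, hval]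
      have h3k : (3 : ℤ) • k = 0 := Subtype.ext ((Submodule.mem_torsionBy_iff _ _).mp k.2)
      have : ((2 : ℕ) : ℤ) • k = -k + (3 : ℤ) • k := by
        rw [show ((2 : ℕ) : ℤ) = -1 + 3 by norm_num, add_smul, neg_one_zsmul]
      rw [this, h3k, add_zero]
  rcases line_eq_or_inf_eq_bot hΦVcard hK with heq | hinf
  · -- `e(Φ) = K`: `D` fixes `Φ` pointwise
    apply h1
    intro g hg P hP
    have hePK : e P ∈ K := heq ▸ (hmem P).mpr hP
    apply e.injective
    by_cases hsg : g • geomSqrt (-3 : ℚ) = geomSqrt (-3 : ℚ)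
    · rw [hpos g hsg, (hKact g hg _ hePK).1 hsg]
    · rw [hneg g hsg, (hKact g hg _ hePK).2 hsg, neg_neg]
  · -- `e(Φ) ∩ K = 0`: `D` acts trivially on `W[3]/Φ`
    apply h2
    intro g hg P
    have hne : ΦV ≠ K := fun h ↦ by
      rw [h, inf_idem] at hinf
      haveI : Finite K := Nat.finite_of_card_ne_zero (by rw [hK]; norm_num)
      have := hK; rw [hinf, AddSubgroup.card_bot] at this; norm_num at this
    obtain ⟨-, hsup⟩ := SemistableTwistLocalAnyLine.inf_eq_bot_and_sup_eq_top_of_ne hpP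
      (Rank1Residual.natCard_geomTorsion V 3) hΦVcard hK hne
    have hx : e P ∈ ΦV ⊔ K := by rw [hsup]; exact AddSubgroup.mem_top _
    obtain ⟨a, ha, k, hk, hak⟩ := AddSubgroup.mem_sup.mp hx
    -- `g a = a`: `g a − a ∈ ΦV ∩ K = 0`
    have hga : g • a = a := by
      have h3 : g • a - a ∈ ΦV ⊓ K := ⟨ΦV.sub_mem (hstab g a ha) ha, hKD g hg a⟩
      rw [hinf, AddSubgroup.mem_bot, sub_eq_zero] at h3
      exact h3
    rw [← hmem, map_sub]
    by_cases hsg : g • geomSqrt (-3 : ℚ) = geomSqrt (-3 : ℚ)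
    · rw [hpos g hsg, ← hak, smul_add, hga, (hKact g hg k hk).1 hsg, sub_self]
      exact ΦV.zero_mem
    · rw [hneg g hsg, ← hak, smul_add, hga, (hKact g hg k hk).2 hsg, neg_add, neg_neg]
      have : -a + k - (a + k) = -((2 : ℕ) • a) := by rw [two_nsmul]; abel
      rw [this]
      exact ΦV.neg_mem (ΦV.nsmul_mem ha 2)

end Abstract

/-! ### §3 The negative lemma for a SPLIT multiplicative `(−3)`-twist, and the (M) cell -/

section NegativeMult

variable {V W : WeierstrassCurve ℚ} [V.IsElliptic] [W.IsElliptic]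

/-- **For a SPLIT multiplicative `V` at `3` and `W = C • V^{(−3)}` with `W[3]` reducible, CGLS's local clause FAILS:** there are a place
`v ∋ 3`, a prime `𝔓 ∣ v` and a rational line `Φ ≤ W[3]` such that `D_𝔓` fixes `Φ` pointwise or acts trivially on `W[3]/Φ` — the negation of
the `hna` binder of generations 23–25 (`W[3]|_{D} ~ (δ ∗; 0 ωδ)` with `δ = 𝟙` for split `V`).  §1 (Tate line, trivial quotient) fed to §2.
The non-split twin (clause HOLDS) is generation 25's `not_fix_and_not_quot_of_nonsplitMult_pStar_twist`.
[cite: SilvermanATAEC1994, Ch. V Thm. 3.1 (c),(d), Thm. 5.3] [cite: GreenbergVatsal2000, §2 pp. 14–15]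
[cite: CastellaGrossiLeeSkinner2022, §1.2 (hypothesis θ|_{G_v̄} ≠ 𝟙, ω)] -/
theorem not_hna_of_splitMult_negThree_twist (hsplit : V.HasSplitMultiplicativeReductionAtPrime 3)
    (C : VariableChange ℚ) (hC : C • V.quadraticTwist (-3 : ℚ) = W) (hred : Red W 3) :
    ¬ ∀ (v : HeightOneSpectrum (𝓞 ℚ)), ((3 : ℕ) : 𝓞 ℚ) ∈ v.asIdeal →
      ∀ (Φ : AddSubgroup (geomTorsion W (3 : ℤ))), IsRationalLine W 3 Φ →
      ∀ 𝔓 ∈ v.primesAbove,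
        (¬ ∀ g ∈ 𝔓.decompositionSubgroup (absoluteGaloisGroup ℚ), ∀ P ∈ Φ, g • P = P) ∧
          (¬ ∀ g ∈ 𝔓.decompositionSubgroup (absoluteGaloisGroup ℚ),
            ∀ P : geomTorsion W (3 : ℤ), g • P - P ∈ Φ) := by
  have hpP : Nat.Prime 3 := Fact.out
  obtain ⟨v, hpv⟩ := Literature.NumberTheory.NumberFields.RingOfIntegers.exists_heightOneSpectrum_natCast_mem ℚ hpP
  obtain ⟨𝔓, h𝔓, K, hK, hKD⟩ := exists_prime_line_trivialQuot_of_split V 3 hsplit hpv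
  exact not_hna_of_line_trivialQuot_negThree_twist C hC hred hpv h𝔓 hK hKD

variable (W)

/-- **The (M) cell at `p = 3`: a SPLIT multiplicative `(−3)`-twist model kills the non-anomalous clause** — for the 3 256 of 4 383 census pairs
of `ClassX3 ∧ SubM` at `p = 3` whose twist `E^{(−3)}` is split multiplicative (kit j319291) the `hna` binder of generations 23–25 is FALSE, so
CGLS 2022 Prop. 14 cannot be invoked for them through this road (their residual characters are `{𝟙, ω}` on `D_𝔓`).  The binder shape of the
model (`Mult V 3 ∧ C • V^{(p*)} = W` at `p = 3`) is that of `AdditivePotMult.PotMult.exists_mult_pStar_twist_model`.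
[cite: CastellaGrossiLeeSkinner2022, §1.2 Prop. 14 (hypothesis)] [cite: SilvermanATAEC1994, Ch. V Thm. 5.3]
[cite: KellerYin2024, §1 (the anomalous case θ|_{G_p} ∈ {𝟙, ω}) (arXiv:2402.12781v2)] -/
theorem not_hna_of_classX3_of_subM_of_exists_split_twist (hX : ClassX3 W 3)
    (hex : ∃ (V : WeierstrassCurve ℚ) (_ : V.IsElliptic) (_ : V.IsGloballyMinimal) (C : VariableChange ℚ),
      Mult V 3 ∧ C • V.quadraticTwist ((-1 : ℚ) ^ (3 / 2) * (3 : ℕ)) = W ∧ V.HasSplitMultiplicativeReductionAtPrime 3) :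
    ¬ ∀ (v : HeightOneSpectrum (𝓞 ℚ)), ((3 : ℕ) : 𝓞 ℚ) ∈ v.asIdeal →
      ∀ (Φ : AddSubgroup (geomTorsion W (3 : ℤ))), IsRationalLine W 3 Φ →
      ∀ 𝔓 ∈ v.primesAbove,
        (¬ ∀ g ∈ 𝔓.decompositionSubgroup (absoluteGaloisGroup ℚ), ∀ P ∈ Φ, g • P = P) ∧
          (¬ ∀ g ∈ 𝔓.decompositionSubgroup (absoluteGaloisGroup ℚ),
            ∀ P : geomTorsion W (3 : ℤ), g • P - P ∈ Φ) := by
  obtain ⟨V, _, _, C, -, hC, hsplit⟩ := hex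
  have h3 : ((-1 : ℚ) ^ (3 / 2)) * (3 : ℕ) = -3 := by norm_num
  rw [h3] at hC
  exact not_hna_of_splitMult_negThree_twist hsplit C hC hX.1

/-- **Contrapositive, the shape of generation 25's positive clause:** on the (M) cell at `p = 3`, if the `hna` binder HOLDS then EVERY
multiplicative `(−3)`-twist model of `W` is NON-SPLIT — i.e. generation 25's per-pair hypothesis NST(W, 3) of
`not_fix_and_not_quot_of_classX3_of_subM_of_forall_twist` is not only sufficient but NECESSARY for the CGLS local clause.
[cite: CastellaGrossiLeeSkinner2022, §1.2 Prop. 14 (hypothesis)] [cite: SilvermanATAEC1994, Ch. V Thm. 5.3] -/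
theorem forall_twist_not_split_of_hna (hX : ClassX3 W 3)
    (hna : ∀ (v : HeightOneSpectrum (𝓞 ℚ)), ((3 : ℕ) : 𝓞 ℚ) ∈ v.asIdeal →
      ∀ (Φ : AddSubgroup (geomTorsion W (3 : ℤ))), IsRationalLine W 3 Φ →
      ∀ 𝔓 ∈ v.primesAbove,
        (¬ ∀ g ∈ 𝔓.decompositionSubgroup (absoluteGaloisGroup ℚ), ∀ P ∈ Φ, g • P = P) ∧
          (¬ ∀ g ∈ 𝔓.decompositionSubgroup (absoluteGaloisGroup ℚ),
            ∀ P : geomTorsion W (3 : ℤ), g • P - P ∈ Φ)) :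
    ∀ (V : WeierstrassCurve ℚ) [V.IsElliptic] [V.IsGloballyMinimal] (C : VariableChange ℚ),
      Mult V 3 → C • V.quadraticTwist ((-1 : ℚ) ^ (3 / 2) * (3 : ℕ)) = W → ¬ V.HasSplitMultiplicativeReductionAtPrime 3 := by
  intro V _ _ C hV hC hsplit
  exact not_hna_of_classX3_of_subM_of_exists_split_twist W hX ⟨V, inferInstance, inferInstance, C, hV, hC, hsplit⟩ hna

end NegativeMult

end Summit.BirchSwinnertonDyer.BirchSwinnertonDyer.Theorems.SchneiderFreeAdditiveX3.SemistableTwistLocalThree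

end
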